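/-
Copyright (c) 2026. All rights reserved.
Released under Apache 2.0 license as described in the file LICENSE.
Authors: abc-iut cell, F-wave seat abc-iut-f-101 (gen 6), over abc-iut-w6-d025 / abc-iut-L4-t8's sum of `⋉`-carriers
(`Ltimes/LogFrobeniusSettingSum`, `…SumLtimesCarriers`) and this seat's Cor 5.5 (iii) observables over `⋉`.
-/
import Literature.AnabelianGeometry.AbsoluteAnabelian.Ltimes.LogFrobeniusSettingSumLtimesIotaOver
import Literature.AnabelianGeometry.AbsoluteAnabelian.Ltimes.LogFrobeniusSettingSumLtimesCarriers
import Literature.AnabelianGeometry.AbsoluteAnabelian.Ltimes.LogFrobeniusMonoTelecoreObservablesCarriers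
import HarnessLib

/-!
# [AbsTopIII] Cor 5.5 (iii): the observables `S_log⊞`, `S_log` over the `⋉`-successor AT THE SUM OF CARRIERS

S. Mochizuki, *Topics in absolute anabelian geometry III*, J. Math. Sci. Univ. Tokyo 22 (2015) [MochizukiAbsTopIII2015],
Def 5.4 (iii) p. 126 (the commutative square `𝒪^× ↪ k̄^× → (k̄^×)^pf`, `𝒪^× → k~ ↪ (k̄^×)^pf`), Def 5.4 (vii) p. 128
(`ι⊞_{v,ε}`), Cor 5.5 (iii) p. 131 («… determines … a structure of observable `S_log⊞` … `S_log` …»).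

Cell slice T9-E «OBS@⋉-CARRIERS», the «(α)» of L4-lead m197 at the SETTING OF RECORD (L4-lead m191): the two Cor 5.5 (iii)
observable STRUCTURES over `⋉` at the two-sided sum `genuineTwoSidedSumLtimes p 𝔄 V₁ V₂ = (genuineOpen p V₁).toLtimes.sum
(archGenuinePlus 𝔄 V₂ _)`, i.e. the `hplus` / `hts` binders of abc-iut-L4-t11's (c)-clause rows and of this seat's
(b)-clause rows there:

* §1 ★ `iotaSquaresCommute_sum_inl` — **the commuting `ι⊞`-squares of the FIRST summand are commuting squares of the sum** at
  its places: in abc-iut-w6-d025's sum the category `𝒩⊞_{inl v}` is `𝒩⊞₁_v × 𝒳₂`, `λ⊞ = λ₁ × 𝟭`, and `ι⊞_{inl v,ε} = ι₁ × (Λ₂ ⟶ 𝟭)`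
  behind an `eqToHom`; at the pre-log sources of a square the twist is the identity, so the second components of all four
  arrows are identities and the first components are `ι₁`-components (`sum_inl_square_arrow`: a free twist parameter `c` with
  `c = false` makes the case analysis type-correct, as in abc-iut-L4-t11's `iotaOver_sum_aux_inl`); symmetrically
  `iotaSquaresCommute_sum_inr`;
* §3 ★ `lamOverLink_sum` — the add-on law `LamOverLink` of the sum from that of the summands (`NatIso.prod` respects `HEq` in a
  factor whose source functor varies propositionally); `archGenuinePlus_lamOverLink`, `genuineTwoSidedSumLtimes_lamOverLink`;
* §2 at the setting of record: ★ `genuineTwoSidedSumLtimes_iotaSquaresCommute` (places of `V₁`: abc-iut-w5-d053's genuine square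
  read over `⋉` and glued; places of `V₂`: archimedean, AUTOMATIC — the `⋉`-graph is linear, `iotaSquaresCommute_of_isArc`),
  ★★ `genuineTwoSidedSumLtimes_cor55Observables`, ★★ `genuineTwoSidedSumLtimes_cor55ObservablesTS (TS)` for EVERY `TS`-datum,
  and the observables realised by the universal families (`…_isLogObservable_pair`).

MODEL-LEVEL (a carrier of OUR successor typing); refereed pre-IUT material; nothing here bears on [IUTchIII] Cor. 3.12; no side
taken; instantiated ≠ endorsed; typed ≠ proved.
-/

set_option autoImplicit false

universe u

open CategoryTheory

namespace Literature.AnabelianGeometry.AbsoluteAnabelian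

namespace LogFrobeniusSettingLtimes

/-! ## §1. The `⊞`-squares of a summand are `⊞`-squares of the sum -/

section Sum

variable {V₁ V₂ : Type u} {isArc₁ : V₁ → Bool} {isArc₂ : V₂ → Bool}
  (Lt₁ : LogFrobeniusSettingLtimes V₁ isArc₁) (Lt₂ : LogFrobeniusSettingLtimes V₂ isArc₂)

/-- Components of an arrow of the sum's square at a place of the FIRST summand, for a free twist parameter `c = false`
(pre-log source): an arrow `HEq` to `(eqToHom ≫ ι₁ × (Λ₂ ⟶ 𝟭))_X₀` has FIRST component `HEq` to `(ι₁)_{X₀.1}` and SECOND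
component the identity. [cite: MochizukiAbsTopIII2015, Def 5.4 (vii) p. 128] -/
theorem sum_inl_square_arrow (c : Bool) (hc : c = false) (v : V₁) (ν₁ ν₂ : LogVertex (isArc₁ v))
    (α : frobeniusTwist Lt₁.log c ⋙ Lt₁.lam v ν₁ ⟶ Lt₁.lam v ν₂) (X₀ : Lt₁.X × Lt₂.X)
    (m : ((Lt₁.sum Lt₂).lam (.inl v) ν₁).obj X₀ ⟶ ((Lt₁.sum Lt₂).lam (.inl v) ν₂).obj X₀)
    (hm : HEq m ((eqToHom (twist_comp_sumLam_inl Lt₁ Lt₂ c v ν₁) ≫ NatTrans.prod α (Lt₂.twistToId c)).app X₀)) :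
    HEq m.1 (α.app X₀.1) ∧ m.2 = 𝟙 X₀.2 := by
  subst hc
  obtain ⟨x₁, x₂⟩ := X₀
  have hm' := eq_of_heq hm
  subst hm'
  dsimp only [LogFrobeniusSettingLtimes.sum, sumLam, sumNplusCat, Cat.of, Bundled.of, twistToId]
  erw [NatTrans.comp_app, eqToHom_app]
  refine ⟨?_, ?_⟩
  · erw [fst_eqToHom_comp_prod_app]
    exact (eqToHom_comp_heq_iff _ _ _).2 HEq.rfl
  · erw [snd_eqToHom_comp_prod_app, NatTrans.id_app, Category.comp_id]
    rfl

/-- The same at a place of the SECOND summand (rôles of the factors exchanged). [cite: MochizukiAbsTopIII2015, Def 5.4 (vii) p. 128] -/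
theorem sum_inr_square_arrow (c : Bool) (hc : c = false) (v : V₂) (ν₁ ν₂ : LogVertex (isArc₂ v))
    (α : frobeniusTwist Lt₂.log c ⋙ Lt₂.lam v ν₁ ⟶ Lt₂.lam v ν₂) (X₀ : Lt₁.X × Lt₂.X)
    (m : ((Lt₁.sum Lt₂).lam (.inr v) ν₁).obj X₀ ⟶ ((Lt₁.sum Lt₂).lam (.inr v) ν₂).obj X₀)
    (hm : HEq m ((eqToHom (twist_comp_sumLam_inr Lt₁ Lt₂ c v ν₁) ≫ NatTrans.prod (Lt₁.twistToId c) α).app X₀)) :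
    m.1 = 𝟙 X₀.1 ∧ HEq m.2 (α.app X₀.2) := by
  subst hc
  obtain ⟨x₁, x₂⟩ := X₀
  have hm' := eq_of_heq hm
  subst hm'
  dsimp only [LogFrobeniusSettingLtimes.sum, sumLam, sumNplusCat, Cat.of, Bundled.of, twistToId]
  erw [NatTrans.comp_app, eqToHom_app]
  refine ⟨?_, ?_⟩
  · erw [fst_eqToHom_comp_prod_app, NatTrans.id_app, Category.comp_id]
    rfl
  · erw [snd_eqToHom_comp_prod_app]
    exact (eqToHom_comp_heq_iff _ _ _).2 HEq.rfl

/-- ★ **The commuting `ι⊞`-squares of the first summand are commuting `ι⊞`-squares of the sum** at its places: componentwise,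
the first components form the summand's square and the second components are identities (all four sources are pre-log).
[cite: MochizukiAbsTopIII2015, Def 5.4 (iii) p. 126] -/
theorem iotaSquaresCommute_sum_inl {v : V₁} (h : Lt₁.IotaSquaresCommute v) :
    (Lt₁.sum Lt₂).IotaSquaresCommute (Sum.inl v) := by
  intro ν₁ ν₂ ν₂' ν₃ h₁ h₂ h₂' h₃ ε₁₂ ε₂₃ ε₁₂' ε₂'₃ X₀ m₁₂ m₂₃ m₁₂' m₂'₃ hm₁₂ hm₂₃ hm₁₂' hm₂'₃
  rw [sum_iota_inl] at hm₁₂ hm₂₃ hm₁₂' hm₂'₃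
  obtain ⟨a₁₂, b₁₂⟩ := sum_inl_square_arrow Lt₁ Lt₂ _ h₁ v ν₁ ν₂ (Lt₁.iota v ε₁₂) X₀ m₁₂ hm₁₂
  obtain ⟨a₂₃, b₂₃⟩ := sum_inl_square_arrow Lt₁ Lt₂ _ h₂ v ν₂ ν₃ (Lt₁.iota v ε₂₃) X₀ m₂₃ hm₂₃
  obtain ⟨a₁₂', b₁₂'⟩ := sum_inl_square_arrow Lt₁ Lt₂ _ h₁ v ν₁ ν₂' (Lt₁.iota v ε₁₂') X₀ m₁₂' hm₁₂'
  obtain ⟨a₂'₃, b₂'₃⟩ := sum_inl_square_arrow Lt₁ Lt₂ _ h₂' v ν₂' ν₃ (Lt₁.iota v ε₂'₃) X₀ m₂'₃ hm₂'₃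
  have k := h h₁ h₂ h₂' h₃ ε₁₂ ε₂₃ ε₁₂' ε₂'₃ X₀.1 m₁₂.1 m₂₃.1 m₁₂'.1 m₂'₃.1 a₁₂ a₂₃ a₁₂' a₂'₃
  apply Prod.ext
  · exact k
  · show m₁₂.2 ≫ m₂₃.2 = m₁₂'.2 ≫ m₂'₃.2
    rw [b₁₂, b₂₃, b₁₂', b₂'₃]
    rfl

/-- ★ The same for the second summand. [cite: MochizukiAbsTopIII2015, Def 5.4 (iii) p. 126] -/
theorem iotaSquaresCommute_sum_inr {v : V₂} (h : Lt₂.IotaSquaresCommute v) :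
    (Lt₁.sum Lt₂).IotaSquaresCommute (Sum.inr v) := by
  intro ν₁ ν₂ ν₂' ν₃ h₁ h₂ h₂' h₃ ε₁₂ ε₂₃ ε₁₂' ε₂'₃ X₀ m₁₂ m₂₃ m₁₂' m₂'₃ hm₁₂ hm₂₃ hm₁₂' hm₂'₃
  rw [sum_iota_inr] at hm₁₂ hm₂₃ hm₁₂' hm₂'₃
  obtain ⟨b₁₂, a₁₂⟩ := sum_inr_square_arrow Lt₁ Lt₂ _ h₁ v ν₁ ν₂ (Lt₂.iota v ε₁₂) X₀ m₁₂ hm₁₂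
  obtain ⟨b₂₃, a₂₃⟩ := sum_inr_square_arrow Lt₁ Lt₂ _ h₂ v ν₂ ν₃ (Lt₂.iota v ε₂₃) X₀ m₂₃ hm₂₃
  obtain ⟨b₁₂', a₁₂'⟩ := sum_inr_square_arrow Lt₁ Lt₂ _ h₁ v ν₁ ν₂' (Lt₂.iota v ε₁₂') X₀ m₁₂' hm₁₂'
  obtain ⟨b₂'₃, a₂'₃⟩ := sum_inr_square_arrow Lt₁ Lt₂ _ h₂' v ν₂' ν₃ (Lt₂.iota v ε₂'₃) X₀ m₂'₃ hm₂'₃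
  have k := h h₁ h₂ h₂' h₃ ε₁₂ ε₂₃ ε₁₂' ε₂'₃ X₀.2 m₁₂.2 m₂₃.2 m₁₂'.2 m₂'₃.2 a₁₂ a₂₃ a₁₂' a₂'₃
  apply Prod.ext
  · show m₁₂.1 ≫ m₂₃.1 = m₁₂'.1 ≫ m₂'₃.1
    rw [b₁₂, b₂₃, b₁₂', b₂'₃]
    rfl
  · exact k

/-- Hence: a sum of carriers with commuting `ι⊞`-squares at every place has commuting `ι⊞`-squares at every place, so carries the
observables `S_log⊞` (and `S_log`, for every `TS`-datum) of Cor 5.5 (iii) over `⋉`. [cite: MochizukiAbsTopIII2015, Cor 5.5 (iii) p. 131] -/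
theorem iotaSquaresCommute_sum (h₁ : ∀ v, Lt₁.IotaSquaresCommute v) (h₂ : ∀ v, Lt₂.IotaSquaresCommute v) :
    ∀ v, (Lt₁.sum Lt₂).IotaSquaresCommute v
  | .inl v => iotaSquaresCommute_sum_inl Lt₁ Lt₂ (h₁ v)
  | .inr v => iotaSquaresCommute_sum_inr Lt₁ Lt₂ (h₂ v)

/-- `Cor55Observables` of a sum from the squares of the summands. [cite: MochizukiAbsTopIII2015, Cor 5.5 (iii) p. 131] -/
theorem cor55Observables_sum (h₁ : ∀ v, Lt₁.IotaSquaresCommute v) (h₂ : ∀ v, Lt₂.IotaSquaresCommute v) :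
    (Lt₁.sum Lt₂).Cor55Observables :=
  (Lt₁.sum Lt₂).cor55Observables_of_iotaSquaresCommute (iotaSquaresCommute_sum Lt₁ Lt₂ h₁ h₂)

/-- `Cor55ObservablesTS` of a sum, for EVERY `TS`-datum on it, from the squares of the summands.
[cite: MochizukiAbsTopIII2015, Cor 5.5 (iii) p. 131] -/
theorem cor55ObservablesTS_sum (h₁ : ∀ v, Lt₁.IotaSquaresCommute v) (h₂ : ∀ v, Lt₂.IotaSquaresCommute v)
    (TS : (Lt₁.sum Lt₂).TSHomotopies) : (Lt₁.sum Lt₂).Cor55ObservablesTS TS :=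
  (Lt₁.sum Lt₂).cor55ObservablesTS_of_iotaSquaresCommute TS (iotaSquaresCommute_sum Lt₁ Lt₂ h₁ h₂)

end Sum

/-! ## §3. `LamOverLink` of a sum of carriers -/

section ProdHEq

/-- `NatIso.prod` respects `HEq` in the first factor when the source functor varies propositionally (bookkeeping). [folklore] -/
private theorem heq_prod_iso_of_heq_left {A₁ B₁ A₂ B₂ : Type*} [Category A₁] [Category B₁] [Category A₂] [Category B₂]
    {F F' G : A₁ ⥤ B₁} (e : F = F') {α : F ≅ G} {α' : F' ≅ G} (h : HEq α α') {H K : A₂ ⥤ B₂} (β : H ≅ K) :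
    HEq (NatIso.prod α β) (NatIso.prod α' β) := by
  subst e; cases h; rfl

/-- `NatIso.prod` respects `HEq` in the second factor when the source functor varies propositionally (bookkeeping). [folklore] -/
private theorem heq_prod_iso_of_heq_right {A₁ B₁ A₂ B₂ : Type*} [Category A₁] [Category B₁] [Category A₂] [Category B₂]
    {F G : A₁ ⥤ B₁} (β : F ≅ G) {H H' K : A₂ ⥤ B₂} (e : H = H') {α : H ≅ K} {α' : H' ≅ K} (h : HEq α α') :
    HEq (NatIso.prod β α) (NatIso.prod β α') := by
  subst e; cases h; rfl

end ProdHEq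

section Sum

variable {V₁ V₂ : Type u} {isArc₁ : V₁ → Bool} {isArc₂ : V₂ → Bool}
  (Lt₁ : LogFrobeniusSettingLtimes V₁ isArc₁) (Lt₂ : LogFrobeniusSettingLtimes V₂ isArc₂)

/-- ★ **`LamOverLink` of abc-iut-w6-d025's sum from that of the summands**: at a place of the first summand the over-structure
of `λ⊞_{inl v,ν}` is `lamOver₁_{v,ν} × (unitors)`, so the `HEq` between the space-link and post-log over-structures is inherited
(the second factor is constant); symmetrically at the places of the second summand. [cite: MochizukiAbsTopIII2015, Cor 5.5 p. 130] -/
theorem lamOverLink_sum (h₁ : Lt₁.LamOverLink) (h₂ : Lt₂.LamOverLink) : (Lt₁.sum Lt₂).LamOverLink := by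
  rintro (v | v)
  · exact heq_prod_iso_of_heq_left
      (congrArg (fun F => F ⋙ Lt₁.forget v ⋙ Lt₁.toE v) (Lt₁.lam_spaceLink_eq_postLog v)) (h₁ v)
      (Lt₂.proj.leftUnitor ≪≫ Lt₂.proj.leftUnitor)
  · exact heq_prod_iso_of_heq_right (Lt₁.proj.leftUnitor ≪≫ Lt₁.proj.leftUnitor)
      (congrArg (fun F => F ⋙ Lt₂.forget v ⋙ Lt₂.toE v) (Lt₂.lam_spaceLink_eq_postLog v)) (h₂ v)

end Sum

/-! ## §2. «(α)» at the setting of record `genuineTwoSidedSumLtimes p 𝔄 V₁ V₂` -/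

section TwoSided

open LogFrobeniusSetting AbsTopIII

variable (p : ℕ) [Fact p.Prime] (𝔄 : AutHolFieldFunctor.{0}) (V₁ V₂ : Type 1)

/-- ★ **the commuting `ι⊞`-squares at EVERY place of the two-sided `⋉`-carrier**: at the places of `V₁` abc-iut-w5-d053's
genuine square read over `⋉` (`iotaSquaresCommute_openLtimes`) glued into the sum; at the (archimedean) places of `V₂`
AUTOMATIC — `Γ⃗^⋉_arc` is linear (`iotaSquaresCommute_of_isArc`). [cite: MochizukiAbsTopIII2015, Def 5.4 (iii) p. 126] -/
theorem genuineTwoSidedSumLtimes_iotaSquaresCommute :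
    ∀ v, (genuineTwoSidedSumLtimes p 𝔄 V₁ V₂).IotaSquaresCommute v
  | .inl v => iotaSquaresCommute_sum_inl _ _ (iotaSquaresCommute_openLtimes p V₁ v)
  | .inr v => (genuineTwoSidedSumLtimes p 𝔄 V₁ V₂).iotaSquaresCommute_of_isArc (Sum.inr v) rfl

/-- ★★ **Cor 5.5 (iii) `⊞`-half HOLDS at the two-sided `⋉`-carrier**: the observable `S_log⊞_v` exists at every place (the
universal family `logObsFamily`). [cite: MochizukiAbsTopIII2015, Cor 5.5 (iii) p. 131] -/
theorem genuineTwoSidedSumLtimes_cor55Observables : (genuineTwoSidedSumLtimes p 𝔄 V₁ V₂).Cor55Observables :=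
  (genuineTwoSidedSumLtimes p 𝔄 V₁ V₂).cor55Observables_of_iotaSquaresCommute
    (genuineTwoSidedSumLtimes_iotaSquaresCommute p 𝔄 V₁ V₂)

/-- ★★ **Cor 5.5 (iii) `TS`-half HOLDS at the two-sided `⋉`-carrier, for EVERY `TS`-datum on it**.
[cite: MochizukiAbsTopIII2015, Cor 5.5 (iii) p. 131] -/
theorem genuineTwoSidedSumLtimes_cor55ObservablesTS (TS : (genuineTwoSidedSumLtimes p 𝔄 V₁ V₂).TSHomotopies) :
    (genuineTwoSidedSumLtimes p 𝔄 V₁ V₂).Cor55ObservablesTS TS :=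
  (genuineTwoSidedSumLtimes p 𝔄 V₁ V₂).cor55ObservablesTS_of_iotaSquaresCommute TS
    (genuineTwoSidedSumLtimes_iotaSquaresCommute p 𝔄 V₁ V₂)

/-- the `TS` ι-diamond law at the two-sided carrier, for every `TS`-datum. [cite: MochizukiAbsTopIII2015, Def 5.4 (vii) p. 128] -/
theorem genuineTwoSidedSumLtimes_iotaSquaresCommuteTS (TS : (genuineTwoSidedSumLtimes p 𝔄 V₁ V₂).TSHomotopies) (v : V₁ ⊕ V₂) :
    (genuineTwoSidedSumLtimes p 𝔄 V₁ V₂).IotaSquaresCommuteTS TS v :=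
  (genuineTwoSidedSumLtimes p 𝔄 V₁ V₂).iotaSquaresCommuteTS_of_iotaSquaresCommute v TS
    (genuineTwoSidedSumLtimes_iotaSquaresCommute p 𝔄 V₁ V₂ v)

/-- the two observable structures at the two-sided carrier as the pair of `IsLogObservable…` facts for the universal families
(the `hobs` binder of this seat's (b)-clause sufficiency theorem). [cite: MochizukiAbsTopIII2015, Cor 5.5 (iii) p. 131] -/
theorem genuineTwoSidedSumLtimes_isLogObservable_pair (TS : (genuineTwoSidedSumLtimes p 𝔄 V₁ V₂).TSHomotopies) (v : V₁ ⊕ V₂) :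
    (genuineTwoSidedSumLtimes p 𝔄 V₁ V₂).IsLogObservablePlus v
        ((genuineTwoSidedSumLtimes p 𝔄 V₁ V₂).logObsFamily v (genuineTwoSidedSumLtimes_iotaSquaresCommute p 𝔄 V₁ V₂ v)) ∧
      (genuineTwoSidedSumLtimes p 𝔄 V₁ V₂).IsLogObservableTS TS v
        ((genuineTwoSidedSumLtimes p 𝔄 V₁ V₂).logObsFamilyTS v TS
          (genuineTwoSidedSumLtimes_iotaSquaresCommuteTS p 𝔄 V₁ V₂ TS v)) :=
  ⟨(genuineTwoSidedSumLtimes p 𝔄 V₁ V₂).isLogObservablePlus_logObsFamily v _,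
    (genuineTwoSidedSumLtimes p 𝔄 V₁ V₂).isLogObservableTS_logObsFamilyTS v TS _⟩

/-- at abc-iut-L4-t6's archimedean carrier of record the over-structures of `λ⊞_{space-link}` and `λ⊞_{post-log}` are the
same identity (Def 5.4 (vi): `λ⊞` lies over `EA` on the nose), at either place type. [cite: MochizukiAbsTopIII2015, Def 5.4 (vi) p. 128] -/
theorem archGenuinePlus_lamOverLink (𝔄 : AutHolFieldFunctor.{0}) (V : Type 1) (isArc : V → Bool) :
    (archGenuinePlus 𝔄 V isArc).LamOverLink := by
  intro v
  have aux : ∀ b : Bool, HEq (archLamPlusOver 𝔄 b (LogVertex.spaceLink b)) (archLamPlusOver 𝔄 b (LogVertex.postLog b)) := by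
    intro b; cases b <;> exact HEq.rfl
  exact aux (isArc v)

/-- `LamOverLink` at the two-sided setting of record (summand-wise: the restricted genuine open carrier, abc-iut-w5-d144's law
read over `⋉`; the archimedean carrier, identities). [cite: MochizukiAbsTopIII2015, Cor 5.5 p. 130] -/
theorem genuineTwoSidedSumLtimes_lamOverLink : (genuineTwoSidedSumLtimes p 𝔄 V₁ V₂).LamOverLink :=
  lamOverLink_sum _ _ (lamOverLink_openLtimes p V₁) (archGenuinePlus_lamOverLink 𝔄 V₂ (fun _ => true))

/-- ★★ **abc-iut-L4-t11's (c)-clause row at the two-sided carrier with `hplus`/`hts` DISCHARGED**: under the orientation cochain,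
for ANY `TS`-datum, Cor 5.10 (iv)(c)'s observable clause holds — `IotaOver` of the sum is abc-iut-L4-t11's `genuineTwoSidedSumLtimes_iotaOver`; the ONLY remaining binders are the cochain and the `TS`-datum.
[cite: MochizukiAbsTopIII2015, Cor 5.10 (iv)(c) p. 148] -/
theorem genuineTwoSidedSumLtimes_cor510MonoContactObservablesCompatible [Nonempty (V₁ ⊕ V₂)] (c : 𝔄.EA → ℝ)
    (hc : ∀ X : 𝔄.EA, c X = 1 ∨ c X = -1)
    (hcob : ∀ {X Y : 𝔄.EA} (f : X ⟶ Y), AutHolFieldFunctor.transitionSign f = c X * c Y)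
    (TS : (genuineTwoSidedSumLtimes p 𝔄 V₁ V₂).TSHomotopies) :
    (genuineTwoSidedSumLtimes p 𝔄 V₁ V₂).Cor510MonoContactObservablesCompatible TS :=
  genuineTwoSidedSumLtimes_cor510MonoContactObservablesCompatible_of_observables p 𝔄 V₁ V₂ c hc hcob TS
    (genuineTwoSidedSumLtimes_cor55Observables p 𝔄 V₁ V₂) (genuineTwoSidedSumLtimes_cor55ObservablesTS p 𝔄 V₁ V₂ TS)

end TwoSided

end LogFrobeniusSettingLtimes

end Literature.AnabelianGeometry.AbsoluteAnabelian
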